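import Literature.Geometry.Symplectic.LegendrianRealisationOnPage
import Mathlib.Analysis.Calculus.BumpFunction.InnerProduct
import HarnessLib

/-!
# Legendrian realisation on a page: the dual form need only be page-closed near that page

Topic `Literature/Geometry/Symplectic`; proofs-only sequel of `LegendrianRealisationOnPage.lean`
(`OpenBook.IsGirouxForm.exists_girouxForm_legendrian`: a curve `γ` on the page `π = c` of a
supporting open book becomes Legendrian for a Giroux form of the SAME open book, of the same sign,
provided a smooth `1`-form `η` vanishing on binding tubes with `dη|_{pages} = 0` and `∮_γ η ≠ 0`
is given).  Here the hypothesis "`dη` vanishes on pairs of vectors tangent to the pages" is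
weakened from ALL pages to the pages NEAR the page of `γ`
(`exists_girouxForm_legendrian_local`, `exists_steinStructure_isGirouxForm_legendrian_local`):
multiply `η` by `χ(π(y))` for a bump `χ` of `ℝ²` centred at `c` — a function of the fibration
kills no period along `γ ⊂ {π = c}` and, its differential vanishing on page-tangent vectors
(`mfderiv_coe_proj_eq_zero_of_angularDeriv_eq_zero`: the fibration read in `ℝ²` has differential
tangent to the circle, so it vanishes exactly where the angular differential does), keeps the
product page-closed wherever `η` was or `χ ∘ π` vanishes.  This is the form in which the
one-handle step of `Literature.Geometry.Symplectic.palf_stein_supportedByBoundaryOpenBook` produces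
`η` (a closed form near the page of the vanishing cycle, extended by a cut-off in the fibration
direction).  Everything is proved; no definitions, no named facts.

## References
* J. B. Etnyre, *Lectures on open book decompositions and contact structures* (2006), proof of
  Thm. 5.6 with the remark in the proof of Lemma 4.10 (Legendrian realisation on a page).
  [Etnyre2006]
* K. Honda, *On the classification of tight contact structures I*, Geom. Topol. 4 (2000),
  Thm. 3.7. [Honda2000]
-/

noncomputable section

open scoped Manifold ContDiff Topology InnerProductSpace
open Set Function Filter
open Literature.Geometry.Kaehler Literature.Topology.FourManifolds

namespace Literature.Geometry.Symplectic

universe u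

variable {M : Type u} [TopologicalSpace M] [ChartedSpace (EuclideanSpace ℝ (Fin 3)) M] [IsManifold (𝓡 3) ∞ M]

namespace OpenBook

variable {ob : OpenBook M}

/-! ### The fibration read in `ℝ²`: its differential is tangent to the circle -/

/-- **`⟪π(y), Dπ_y(u)⟫ = 0`**: the differential of the fibration read in `ℝ²` takes values in the
tangent line of the unit circle at `π(y)` (chain rule through the inclusion `𝕊¹ ⊂ ℝ²`, whose
differential has range `π(y)^⊥`). [folklore] -/
theorem inner_proj_mfderiv_coe_proj [T2Space M] {y : M} (hy : y ∉ ob.binding) (u : EuclideanSpace ℝ (Fin 3)) :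
    ⟪((ob.proj y : (Metric.sphere (0 : EuclideanSpace ℝ (Fin (1 + 1))) 1)) : EuclideanSpace ℝ (Fin 2)),
      mfderiv (𝓡 3) 𝓘(ℝ, EuclideanSpace ℝ (Fin 2)) (fun z => ((ob.proj z : (Metric.sphere (0 : EuclideanSpace ℝ (Fin (1 + 1))) 1)) : EuclideanSpace ℝ (Fin 2))) y u⟫_ℝ = 0 := by
  haveI : Fact (Module.finrank ℝ (EuclideanSpace ℝ (Fin 2)) = 1 + 1) := ⟨by simp⟩
  have h1 : ContMDiffAt (𝓡 3) (𝓡 1) ∞ ob.proj y :=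
    ob.contMDiffOn_proj.contMDiffAt (ob.isOpen_compl_binding.mem_nhds hy)
  have hpd : MDifferentiableAt (𝓡 3) (𝓡 1) ob.proj y := h1.mdifferentiableAt (by simp)
  have hcd : MDifferentiableAt (𝓡 1) 𝓘(ℝ, EuclideanSpace ℝ (Fin 2)) ((↑) : ((Metric.sphere (0 : EuclideanSpace ℝ (Fin (1 + 1))) 1)) → EuclideanSpace ℝ (Fin 2)) (ob.proj y) :=
    (contMDiff_coe_sphere (n := 1) (m := ∞) (ob.proj y)).mdifferentiableAt (by simp)
  have hcomp : mfderiv (𝓡 3) 𝓘(ℝ, EuclideanSpace ℝ (Fin 2)) (fun z => ((ob.proj z : (Metric.sphere (0 : EuclideanSpace ℝ (Fin (1 + 1))) 1)) : EuclideanSpace ℝ (Fin 2))) y =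
      (mfderiv (𝓡 1) 𝓘(ℝ, EuclideanSpace ℝ (Fin 2)) ((↑) : ((Metric.sphere (0 : EuclideanSpace ℝ (Fin (1 + 1))) 1)) → EuclideanSpace ℝ (Fin 2)) (ob.proj y)).comp
        (mfderiv (𝓡 3) (𝓡 1) ob.proj y) := mfderiv_comp y hcd hpd
  have hmem : mfderiv (𝓡 3) 𝓘(ℝ, EuclideanSpace ℝ (Fin 2)) (fun z => ((ob.proj z : (Metric.sphere (0 : EuclideanSpace ℝ (Fin (1 + 1))) 1)) : EuclideanSpace ℝ (Fin 2))) y u ∈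
      (ℝ ∙ ((ob.proj y : (Metric.sphere (0 : EuclideanSpace ℝ (Fin (1 + 1))) 1)) : EuclideanSpace ℝ (Fin 2)))ᗮ := by
    rw [hcomp, ContinuousLinearMap.comp_apply, ← range_mfderiv_coe_sphere (n := 1) (ob.proj y)]
    exact LinearMap.mem_range_self _ _
  exact (Submodule.mem_orthogonal_singleton_iff_inner_right (𝕜 := ℝ)).1 hmem

/-- **A page-tangent vector is killed by the differential of the fibration read in `ℝ²`**:
`dθ_y(u) = 0 ⇒ D(ι ∘ π)_y(u) = 0` (the vector `D(ι ∘ π)u` is tangent to the circle at `π(y)` and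
has zero angular component). [folklore] -/
theorem mfderiv_coe_proj_eq_zero_of_angularDeriv_eq_zero [T2Space M] {y : M} (hy : y ∉ ob.binding)
    {u : EuclideanSpace ℝ (Fin 3)} (hu : angularDeriv ob.proj y u = 0) :
    mfderiv (𝓡 3) 𝓘(ℝ, EuclideanSpace ℝ (Fin 2)) (fun z => ((ob.proj z : (Metric.sphere (0 : EuclideanSpace ℝ (Fin (1 + 1))) 1)) : EuclideanSpace ℝ (Fin 2))) y u = 0 := by
  set p : EuclideanSpace ℝ (Fin 2) := ((ob.proj y : (Metric.sphere (0 : EuclideanSpace ℝ (Fin (1 + 1))) 1)) : EuclideanSpace ℝ (Fin 2)) with hp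
  set q : EuclideanSpace ℝ (Fin 2) := mfderiv (𝓡 3) 𝓘(ℝ, EuclideanSpace ℝ (Fin 2)) (fun z => ((ob.proj z : (Metric.sphere (0 : EuclideanSpace ℝ (Fin (1 + 1))) 1)) : EuclideanSpace ℝ (Fin 2))) y u with hq
  have hang : p 0 * q 1 - p 1 * q 0 = 0 := by
    rw [← angleForm_apply]; exact hu
  have hinner : p 0 * q 0 + p 1 * q 1 = 0 := by
    have h : @inner ℝ (EuclideanSpace ℝ (Fin 2)) _ p q = 0 := inner_proj_mfderiv_coe_proj hy u
    simp only [PiLp.inner_apply, RCLike.inner_apply, conj_trivial, Fin.sum_univ_two] at h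
    linarith [h, mul_comm (q 0) (p 0), mul_comm (q 1) (p 1)]
  have hnorm : p 0 ^ 2 + p 1 ^ 2 = 1 := by
    have h1 : ‖p‖ = 1 := by simp [hp]
    rw [EuclideanSpace.norm_eq, Real.sqrt_eq_one, Fin.sum_univ_two, Real.norm_eq_abs,
      Real.norm_eq_abs, sq_abs, sq_abs] at h1
    exact h1
  have hq0 : q 0 = 0 := by linear_combination p 0 * hinner - p 1 * hang - q 0 * hnorm
  have hq1 : q 1 = 0 := by linear_combination p 1 * hinner + p 0 * hang - q 1 * hnorm
  change q = (0 : EuclideanSpace ℝ (Fin 2))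
  ext i
  fin_cases i
  · simpa using hq0
  · simpa using hq1

/-- **A function of the fibration has differential vanishing on page-tangent vectors.**  For
`χ : ℝ² → ℝ` differentiable and `y ∉ B`: `dθ_y(u) = 0 ⇒ d(χ ∘ ι ∘ π)_y(u) = 0`. [folklore] -/
theorem mfderiv_comp_coe_proj_eq_zero [T2Space M] {χ : EuclideanSpace ℝ (Fin 2) → ℝ} (hχ : Differentiable ℝ χ) {y : M}
    (hy : y ∉ ob.binding) {u : EuclideanSpace ℝ (Fin 3)} (hu : angularDeriv ob.proj y u = 0) :
    mfderiv (𝓡 3) 𝓘(ℝ, ℝ) (χ ∘ fun z => ((ob.proj z : (Metric.sphere (0 : EuclideanSpace ℝ (Fin (1 + 1))) 1)) : EuclideanSpace ℝ (Fin 2))) y u = 0 := by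
  have hP := ob.mdifferentiableAt_coe_proj hy
  have hχ' : MDifferentiableAt 𝓘(ℝ, EuclideanSpace ℝ (Fin 2)) 𝓘(ℝ, ℝ) χ ((ob.proj y : (Metric.sphere (0 : EuclideanSpace ℝ (Fin (1 + 1))) 1)) : EuclideanSpace ℝ (Fin 2)) :=
    (hχ _).mdifferentiableAt
  rw [mfderiv_comp y hχ' hP]
  show mfderiv 𝓘(ℝ, EuclideanSpace ℝ (Fin 2)) 𝓘(ℝ, ℝ) χ ((ob.proj y : (Metric.sphere (0 : EuclideanSpace ℝ (Fin (1 + 1))) 1)) : EuclideanSpace ℝ (Fin 2))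
    (mfderiv (𝓡 3) 𝓘(ℝ, EuclideanSpace ℝ (Fin 2)) (fun z => ((ob.proj z : (Metric.sphere (0 : EuclideanSpace ℝ (Fin (1 + 1))) 1)) : EuclideanSpace ℝ (Fin 2))) y u) = 0
  rw [mfderiv_coe_proj_eq_zero_of_angularDeriv_eq_zero hy hu, map_zero]

/-! ### The localisation -/

/-- **Legendrian realisation of a page curve, local form of the page-closedness hypothesis.**
As `exists_girouxForm_legendrian`, but `dη` is only required to vanish on pairs of page-tangent
vectors at the points `y ∉ B` whose fibration value `π(y) ∈ ℝ²` lies within distance `r` of `c`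
(the value of the page of `γ`).  Proof: replace `η` by `(χ ∘ ι ∘ π) · η` for a smooth bump `χ` of
`ℝ²` at `c` with `χ = 1` on the `r/2`-ball and support in the `r`-ball; since `η` vanishes near
the binding the product is smooth, it vanishes on the tubes, its differential
`χ dη + d(χ ∘ ι ∘ π) ∧ η` vanishes on page-tangent pairs everywhere, and along `γ ⊂ {π = c}` it
equals `η`. [cite: Etnyre2006, proof of Thm. 5.6 (arXiv p. 17) with the remark in the proof of Lemma 4.10 (arXiv p. 14)] -/
theorem IsGirouxForm.exists_girouxForm_legendrian_local [T2Space M] [CompactSpace M]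
    (hcores : Pairwise fun i j => Disjoint (range (ob.core i)) (range (ob.core j)))
    {ξ : M → Submodule ℝ (EuclideanSpace ℝ (Fin 3))} {α₀ : MForm (𝓡 3) M ℝ 1} (h₀ : ob.IsGirouxForm ξ α₀)
    {γ : ℝ → M} {T : ℝ} (hT : 0 < T) (hγ : ContMDiff 𝓘(ℝ, ℝ) (𝓡 3) ∞ γ) (hper : Periodic γ T)
    (hinj : InjOn γ (Ico 0 T)) (himm : ∀ t, mfderiv 𝓘(ℝ, ℝ) (𝓡 3) γ t (1 : ℝ) ≠ 0)
    {ε₀ : ℝ} (hε₀ : 0 < ε₀) (hγtube : ∀ t i, γ t ∉ ob.tubeSet i ε₀)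
    {c : (Metric.sphere (0 : EuclideanSpace ℝ (Fin (1 + 1))) 1)} (hγc : ∀ t, ob.proj (γ t) = c)
    {η : MForm (𝓡 3) M ℝ 1} (hη : IsSmoothForm η)
    (hηtube : ∀ i y, y ∈ ob.tubeSet i ε₀ → η y = 0)
    {r : ℝ} (hr : 0 < r)
    (hηpages : ∀ y, y ∉ ob.binding → dist ((ob.proj y : (Metric.sphere (0 : EuclideanSpace ℝ (Fin (1 + 1))) 1)) : EuclideanSpace ℝ (Fin 2)) (c : EuclideanSpace ℝ (Fin 2)) < r →
      ∀ u v : EuclideanSpace ℝ (Fin 3), angularDeriv ob.proj y u = 0 → angularDeriv ob.proj y v = 0 →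
        mextDeriv η y ![u, v] = 0)
    (hηγ : (∫ t in (0 : ℝ)..T, η (γ t) ![mfderiv 𝓘(ℝ, ℝ) (𝓡 3) γ t (1 : ℝ)]) ≠ 0) :
    ∃ α₁ : MForm (𝓡 3) M ℝ 1, ob.IsGirouxForm (kerPlane α₁) α₁ ∧
      (∀ y u v w, 0 < wedge₁₂ (α₀ y) (mextDeriv α₀ y) u v w ↔
        0 < wedge₁₂ (α₁ y) (mextDeriv α₁ y) u v w) ∧
      ∀ t, α₁ (γ t) ![mfderiv 𝓘(ℝ, ℝ) (𝓡 3) γ t (1 : ℝ)] = 0 := by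
  -- the bump in the fibration direction
  let χb : ContDiffBump (c : EuclideanSpace ℝ (Fin 2)) := ⟨r / 2, r, by positivity, by linarith⟩
  set χ : EuclideanSpace ℝ (Fin 2) → ℝ := fun x => χb x with hχdef
  have hχs : ContDiff ℝ ∞ χ := χb.contDiff
  set P : M → EuclideanSpace ℝ (Fin 2) := fun z => ((ob.proj z : (Metric.sphere (0 : EuclideanSpace ℝ (Fin (1 + 1))) 1)) : EuclideanSpace ℝ (Fin 2)) with hPdef
  set g : M → ℝ := χ ∘ P with hgdef
  -- `g` is smooth off the binding
  have hgs : ∀ y, y ∉ ob.binding → ContMDiffAt (𝓡 3) 𝓘(ℝ, ℝ) ∞ g y := by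
    intro y hy
    haveI : Fact (Module.finrank ℝ (EuclideanSpace ℝ (Fin 2)) = 1 + 1) := ⟨by simp⟩
    have h1 : ContMDiffAt (𝓡 3) (𝓡 1) ∞ ob.proj y :=
      ob.contMDiffOn_proj.contMDiffAt (ob.isOpen_compl_binding.mem_nhds hy)
    have h2 : ContMDiffAt (𝓡 3) 𝓘(ℝ, EuclideanSpace ℝ (Fin 2)) ∞ P y :=
      (contMDiff_coe_sphere (n := 1) (m := ∞)).contMDiffAt.comp y h1
    exact hχs.contDiffAt.contMDiffAt.comp y h2
  set η' : MForm (𝓡 3) M ℝ 1 := g • η with hη'def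
  have hη'y : ∀ y, η' y = g y • η y := fun y => rfl
  -- near the binding `η'` vanishes identically
  have hzero : ∀ y, y ∈ ob.binding → ∀ᶠ z in 𝓝 y, η' z = (0 : MForm (𝓡 3) M ℝ 1) z := by
    intro y hyB
    obtain ⟨i, hi⟩ := exists_mem_tubeSet_of_mem_binding hyB hε₀
    filter_upwards [(ob.isOpen_tubeSet i ε₀).mem_nhds hi] with z hz
    rw [hη'y, hηtube i z hz, smul_zero]
    rfl
  -- §1 smoothness
  have hη' : IsSmoothForm η' := by
    intro y
    by_cases hyB : y ∈ ob.binding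
    · exact (MForm.smoothAt_zero y).congr_of_eventuallyEq
        ((hzero y hyB).mono fun z hz => hz.symm)
    · exact MForm.SmoothAt.fun_smul (hgs y hyB) (hη y)
  -- §2 vanishing on the tubes
  have hη'tube : ∀ i y, y ∈ ob.tubeSet i ε₀ → η' y = 0 := fun i y hy => by
    rw [hη'y, hηtube i y hy, smul_zero]
  -- §3 page-closedness everywhere
  have hη'pages : ∀ y, y ∉ ob.binding → ∀ u v : EuclideanSpace ℝ (Fin 3), angularDeriv ob.proj y u = 0 →
      angularDeriv ob.proj y v = 0 → mextDeriv η' y ![u, v] = 0 := by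
    intro y hy u v hu hv
    have hgd : MDifferentiableAt (𝓡 3) 𝓘(ℝ, ℝ) g y := (hgs y hy).mdifferentiableAt (by simp)
    rw [hη'def, mextDeriv_fun_smul_apply hgd (hη y)]
    have hD : fderivWithin ℝ (g ∘ (extChartAt (𝓡 3) y).symm) (range (𝓡 3)) (extChartAt (𝓡 3) y y) =
        mfderiv (𝓡 3) 𝓘(ℝ, ℝ) g y := by
      rw [hgd.mfderiv]
      simp only [writtenInExtChartAt, extChartAt_model_space_eq_id, PartialEquiv.refl_coe,
        Function.id_comp]
    have hχd : Differentiable ℝ χ := hχs.differentiable (by simp)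
    have hgu : mfderiv (𝓡 3) 𝓘(ℝ, ℝ) g y u = 0 := mfderiv_comp_coe_proj_eq_zero hχd hy hu
    have hgv : mfderiv (𝓡 3) 𝓘(ℝ, ℝ) g y v = 0 := mfderiv_comp_coe_proj_eq_zero hχd hy hv
    have h1 : g y • mextDeriv η y ![u, v] = 0 := by
      by_cases hdist : dist (P y) (c : EuclideanSpace ℝ (Fin 2)) < r
      · rw [hηpages y hy hdist u v hu hv, smul_zero]
      · have hg0 : g y = 0 := by
          show χ (P y) = 0
          exact χb.zero_of_le_dist (not_lt.1 hdist)
        rw [hg0, zero_smul]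
    have hDu : fderivWithin ℝ (g ∘ (extChartAt (𝓡 3) y).symm) (range (𝓡 3)) (extChartAt (𝓡 3) y y) u = 0 := by
      rw [hD]; exact hgu
    have hDv : fderivWithin ℝ (g ∘ (extChartAt (𝓡 3) y).symm) (range (𝓡 3)) (extChartAt (𝓡 3) y y) v = 0 := by
      rw [hD]; exact hgv
    rw [h1, zero_add]
    show LinearAlgebra.Alternating.wedgeOne
      (fderivWithin ℝ (g ∘ (extChartAt (𝓡 3) y).symm) (range (𝓡 3)) (extChartAt (𝓡 3) y y))
      (η y) ![u, v] = 0
    rw [wedgeOne_apply_two]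
    show (fderivWithin ℝ (g ∘ (extChartAt (𝓡 3) y).symm) (range (𝓡 3)) (extChartAt (𝓡 3) y y)) u •
        η y ![v] -
      (fderivWithin ℝ (g ∘ (extChartAt (𝓡 3) y).symm) (range (𝓡 3)) (extChartAt (𝓡 3) y y)) v •
        η y ![u] = 0
    rw [hDu, hDv, zero_smul, zero_smul, sub_zero]
  -- §4 the period along `γ ⊂ {π = c}` is unchanged
  have hη'γ : (∫ t in (0 : ℝ)..T, η' (γ t) ![mfderiv 𝓘(ℝ, ℝ) (𝓡 3) γ t (1 : ℝ)]) ≠ 0 := by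
    have e : ∀ t, η' (γ t) ![mfderiv 𝓘(ℝ, ℝ) (𝓡 3) γ t (1 : ℝ)] =
        η (γ t) ![mfderiv 𝓘(ℝ, ℝ) (𝓡 3) γ t (1 : ℝ)] := by
      intro t
      have hPc : P (γ t) = (c : EuclideanSpace ℝ (Fin 2)) := by
        show ((ob.proj (γ t) : (Metric.sphere (0 : EuclideanSpace ℝ (Fin (1 + 1))) 1)) : EuclideanSpace ℝ (Fin 2)) = c
        rw [hγc t]
      have hg1 : g (γ t) = 1 := by
        show χ (P (γ t)) = 1
        apply χb.one_of_mem_closedBall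
        rw [Metric.mem_closedBall, hPc, dist_self]
        exact le_of_lt χb.rIn_pos
      rw [hη'y, ContinuousAlternatingMap.smul_apply, hg1, one_smul]
    simp_rw [e]
    exact hηγ
  exact h₀.exists_girouxForm_legendrian hcores hT hγ hper hinj himm hε₀ hγtube hγc hη' hη'tube
    hη'pages hη'γ

end OpenBook

/-- **The same in Stein form** (cf. `exists_steinStructure_isGirouxForm_legendrian`): for the
complex tangencies of a Stein structure, with `dη` page-closed only near the page of `γ`.
[cite: AkbulutOzbagci2001, proof of Thm. 5] [cite: Etnyre2006, proof of Thm. 5.6 and Prop. 3.18] -/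
theorem exists_steinStructure_isGirouxForm_legendrian_local
    {X : Type} [TopologicalSpace X] [T2Space X] [CompactSpace X]
    [ChartedSpace (EuclideanHalfSpace 4) X] [IsManifold (𝓡∂ 4) ∞ X]
    (bX : BoundaryData (𝓡∂ 4) X (𝓡 3)) (S : SteinStructure X) {ob : OpenBook bX.carrier}
    (hcores : Pairwise fun i j => Disjoint (range (ob.core i)) (range (ob.core j)))
    {α₀ : MForm (𝓡 3) bX.carrier ℝ 1} (h₀ : ob.IsGirouxForm (boundaryPlaneField S.J bX) α₀)
    {γ : ℝ → bX.carrier} {T : ℝ} (hT : 0 < T) (hγ : ContMDiff 𝓘(ℝ, ℝ) (𝓡 3) ∞ γ)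
    (hper : Periodic γ T) (hinj : InjOn γ (Ico 0 T))
    (himm : ∀ t, mfderiv 𝓘(ℝ, ℝ) (𝓡 3) γ t (1 : ℝ) ≠ 0)
    {ε₀ : ℝ} (hε₀ : 0 < ε₀) (hγtube : ∀ t i, γ t ∉ ob.tubeSet i ε₀)
    {c : (Metric.sphere (0 : EuclideanSpace ℝ (Fin (1 + 1))) 1)} (hγc : ∀ t, ob.proj (γ t) = c)
    {η : MForm (𝓡 3) bX.carrier ℝ 1} (hη : IsSmoothForm η)
    (hηtube : ∀ i y, y ∈ ob.tubeSet i ε₀ → η y = 0)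
    {r : ℝ} (hr : 0 < r)
    (hηpages : ∀ y, y ∉ ob.binding → dist ((ob.proj y : (Metric.sphere (0 : EuclideanSpace ℝ (Fin (1 + 1))) 1)) : EuclideanSpace ℝ (Fin 2)) (c : EuclideanSpace ℝ (Fin 2)) < r →
      ∀ u v : EuclideanSpace ℝ (Fin 3), angularDeriv ob.proj y u = 0 → angularDeriv ob.proj y v = 0 →
        mextDeriv η y ![u, v] = 0)
    (hηγ : (∫ t in (0 : ℝ)..T, η (γ t) ![mfderiv 𝓘(ℝ, ℝ) (𝓡 3) γ t (1 : ℝ)]) ≠ 0) :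
    ∃ (S' : SteinStructure X) (α₁ : MForm (𝓡 3) bX.carrier ℝ 1),
      ob.IsGirouxForm (boundaryPlaneField S'.J bX) α₁ ∧
      (∀ y u v w, 0 < wedge₁₂ (α₀ y) (mextDeriv α₀ y) u v w ↔
        0 < wedge₁₂ (α₁ y) (mextDeriv α₁ y) u v w) ∧
      ∀ t, α₁ (γ t) ![mfderiv 𝓘(ℝ, ℝ) (𝓡 3) γ t (1 : ℝ)] = 0 := by
  haveI : CompactSpace bX.carrier := bX.compactSpace_carrier
  haveI : T2Space bX.carrier := bX.isSmoothEmbedding.isEmbedding.t2Space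
  obtain ⟨α₁, hG, hor, hleg⟩ := h₀.exists_girouxForm_legendrian_local hcores hT hγ hper hinj himm hε₀
    hγtube hγc hη hηtube hr hηpages hηγ
  obtain ⟨S', hS'⟩ := exists_steinStructure_isGirouxForm_of_sign_iff bX ob S h₀ hG hor
  exact ⟨S', α₁, hS', hor, hleg⟩

end Literature.Geometry.Symplectic
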